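import Literature.Barriers.CriticalPhenomena.PlaquetteWalkAngleLimitZeta
import Literature.Barriers.CriticalPhenomena.PlaquetteWalkAngleCostParity
import Literature.Barriers.CriticalPhenomena.PlaquetteWalkHoleRootWoundCostNS
import HarnessLib

/-!
# Barrier catalogue (SAWScalingLimit): the `Z → ∞` limit weight of a Yang–Baxter walk is a signed power of `i√2` times an
EIGHTH root of unity read off four turn counts — the PHASE LAW, the wound limit SUM and the HALF-PLANE CRITERION («LIMIT PHASE»)

Continuation of `PlaquetteWalkAngleLimitCoefficient` / `…LimitZeta` / `…LimitCoefficientWound` / `PlaquetteWalkHoleRootWoundCostNS`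
(the `Z → ∞` end of the printed family of [GlazmanManolescu2019, eq. (1)], `Z = e^{3iθ/8}`: the cleared vertex functional
`P = (Z²·Den)^K · VF_D(a, f₀; ·)` has, at a `W`-normalised hole root, `coeff_{4K−4}(P) = Λ₅ = woundLimitCoeff 5`, the level-`5`
partition function of the WOUND group members in the limit model, and `Λ₅ ≠ 0 ⇒ VF ≢ 0`). The limit weight of a walk
(`limitWeight`, `limitWeight_eq_zeta32`: slot unit × `ζ^{27q}` × `(ζ⁴+ζ¹²)^{n_{u₁}}((ζ⁴+ζ¹²)(−ζ⁶))^{n_{u₂}}(ζ¹²)^{n_{w₁}}(−ζ⁴)^{n_{w₂}}`,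
`ζ = e^{iπ/16}`) involves the signed quarter-turn count `q` and the four configuration counts. This file reduces it to COUNTS OF
TURN CLASSES:

* §1–§2 (any mid-edge list). An arc joining the sides `s → t` of a rhombus is in one of four turn classes — `HL` (`W→N`, `E→S`: left
  turn entered horizontally), `HR` (`W→S`, `E→N`), `VL` (`S→W`, `N→E`: left turn entered vertically), `VR` (`N→W`, `S→E`) — or straight.
  `θ`-corner arcs = `HL ∪ VR`, `(π−θ)`-corner arcs = `HR ∪ VL` (`arcKind_eq_corner_iff`, `arcKind_eq_coCorner_iff`); hence
  ★ `quarterTurnsL_eq_classes`: `q = n_{HL} + n_{VL} − n_{HR} − n_{VR}`, `countP_coCorner_eq`: #`(π−θ)`-corner arcs `= n_{HR} + n_{VL}`.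
* §3 (walks: the local configurations are those of Fig. 1, `kindsL_shape`). ★★ `countP_coCorner_eq_cfgCount`: #`(π−θ)`-corner arcs
  `= n_{u₂} + 2n_{w₂}`, `countP_corner_eq_cfgCount`; so ★★ `quarterTurnsL_add_two_coCorner`:
  `q + 2(n_{u₂} + 2n_{w₂}) = n_{H→V} − n_{V→H} + 4n_{VL}`.
* §4 `hvCount_sub_vhCount(_walk)`: `n_{H→V} − n_{V→H} = [a vertical] − [z vertical]` (telescoping along the mid-edges).
* §5 ★★★ THE PHASE LAW `limitWeight_eq_phase`:
  `limitWeight_s(γ) = slotSign s · (ζ⁴+ζ¹²)^{n_{u₁}+n_{u₂}} · (ζ²⁷)^{n_{H→V}−n_{V→H}} · ζ^{slotExp s + 12(n_{VL}+n_{w₁}) + 8n_{w₂}}`, and from a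
  VERTICAL root (★★★ `limitWeight_eq_phase_of_vert`, the hole roots `w.side W` of the lane) the slot unit cancels:
  **`limitWeight_s(γ) = ± (i√2)^{n_{u₁}+n_{u₂}} · ζ₈^{3(n_{VL}+n_{w₁}) + 2n_{w₂}}`** (`ζ₈ = ζ⁴`). The phase of a walk in the limit model is an
  eighth root of unity determined by `n_{VL} + n_{w₁} (mod 8)` and `n_{w₂} (mod 4)` alone.
* §6 `woundLimitSum` (the level-`j` wound partition function WITHOUT the factor `lead(Z²·Den)^K`),
  `woundLimitCoeff_eq_mul_woundLimitSum`, ★★ THE HALF-PLANE CRITERION `woundLimitSum_ne_zero_of_halfPlane` (limit weights confined to a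
  closed half-plane `Re(u·) ≥ 0`, one strictly inside ⇒ no cancellation) and ★★★
  `vertexFunctional_printed_zero_set_finite_of_halfPlane_five`: at a `W`-normalised hole root, such a half-plane configuration of the
  cost-`5` wound members makes `VF_D(a, f₀; ·)` NOT identically zero in the angle (uses `woundCostGE_five`).
* §7 level-`5` arithmetic: `(ζ⁴+ζ¹²)² = −2`, `(ζ⁴+ζ¹²)⁴ = 4`, `Re ζ^k = cos(kπ/16)` and its sign on `k ≤ 8` / `24 ≤ k ≤ 32`.

Use (venture lane «pcv-sawmu», FINDING-YB-LIMIT-MODEL and the b-engine-1 g24 level-`5` class census): the lane's «RECTANGLE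
COEFFICIENT» law (`Λ₅ ≠ 0` at every cell with a cost-`5` wound member; 6 635 / 6 635 cells in kit j271945) becomes, by the phase law,
a statement about the slot signs, `n_{u₁}+n_{u₂} ∈ {4, 5}` and the residues `3(n_{VL}+n_{w₁}) + 2n_{w₂} (mod 8)` of the cost-`5`
members — e.g. on the root row the census classes give limit weights `±4ζ⁴`, `4(±ζ⁴ + ζ¹²)`, all with `Re(ζ^{−12}·) ≥ 0` —, and the
half-plane criterion turns such a class list into `VF ≢ 0`. The classification of the cost-`5` members is NOT made here.
Elementary (list bookkeeping and cyclotomic arithmetic in `ℤ[ζ₃₂]`).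
-/

noncomputable section

open private IsNS from Literature.Probability.RandomPlanarGeometry.YangBaxterSAWGeneralDomain

namespace Literature.Barriers.CriticalPhenomena.PlaquetteWalk

open Literature.Probability.RandomPlanarGeometry.SAW.YangBaxter
open Real Complex Polynomial

/-! ## The four turn classes of an arc -/

section ArcClasses

/-- The ordered pair `(entry side, exit side)` of an arc, read in the rhombus it is drawn in (`none` if the two mid-edges are not
two sides of one rhombus). [cite: GlazmanManolescu2019, §1, Fig. 1 (the arcs of a walk inside a rhombus)] -/
def arcSides (p : MidEdge × MidEdge) : Option (Side × Side) :=
  (arcFace p).bind fun f =>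
    match f.sideOf p.1, f.sideOf p.2 with
    | some s, some t => some (s, t)
    | _, _ => none

/-- A LEFT turn entered through a vertical side (`W → N`, `E → S`): a `θ`-corner arc entered horizontally.
[cite: GlazmanManolescu2019, §1, Fig. 1] -/
def isHL : Side × Side → Bool
  | (.W, .N) | (.E, .S) => true
  | _ => false

/-- A RIGHT turn entered through a vertical side (`W → S`, `E → N`): a `(π−θ)`-corner arc entered horizontally.
[cite: GlazmanManolescu2019, §1, Fig. 1] -/
def isHR : Side × Side → Bool
  | (.W, .S) | (.E, .N) => true
  | _ => false

/-- A LEFT turn entered through a slanted side (`S → W`, `N → E`): a `(π−θ)`-corner arc entered vertically.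
[cite: GlazmanManolescu2019, §1, Fig. 1] -/
def isVL : Side × Side → Bool
  | (.S, .W) | (.N, .E) => true
  | _ => false

/-- A RIGHT turn entered through a slanted side (`N → W`, `S → E`): a `θ`-corner arc entered vertically.
[cite: GlazmanManolescu2019, §1, Fig. 1] -/
def isVR : Side × Side → Bool
  | (.N, .W) | (.S, .E) => true
  | _ => false

/-- The number of arcs of a mid-edge list in a given turn class. [cite: GlazmanManolescu2019, §1, Fig. 1 (lane plumbing)] -/
def classCount (c : Side × Side → Bool) (l : List MidEdge) : ℕ :=
  (arcsOf l).countP fun p => (arcSides p).elim false c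

/-- `n_{HL}`: left turns entered horizontally. [cite: GlazmanManolescu2019, §1, Fig. 1 (lane plumbing)] -/
def hlCount (l : List MidEdge) : ℕ := classCount isHL l
/-- `n_{HR}`: right turns entered horizontally. [cite: GlazmanManolescu2019, §1, Fig. 1 (lane plumbing)] -/
def hrCount (l : List MidEdge) : ℕ := classCount isHR l
/-- `n_{VL}`: left turns entered vertically. [cite: GlazmanManolescu2019, §1, Fig. 1 (lane plumbing)] -/
def vlCount (l : List MidEdge) : ℕ := classCount isVL l
/-- `n_{VR}`: right turns entered vertically. [cite: GlazmanManolescu2019, §1, Fig. 1 (lane plumbing)] -/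
def vrCount (l : List MidEdge) : ℕ := classCount isVR l

/-- The quarter turn of an arc from its class: `+1` for the two left classes, `−1` for the two right classes, `0` otherwise.
[cite: GlazmanManolescu2019, §2.1 (the winding of a walk; lane plumbing)] -/
theorem qTurn_eq_classes (s t : Side) :
    qTurn s t = (if isHL (s, t) then 1 else 0) + (if isVL (s, t) then 1 else 0) -
      (if isHR (s, t) then 1 else 0) - (if isVR (s, t) then 1 else 0) := by
  cases s <;> cases t <;> rfl

/-- A `(π−θ)`-corner arc is a right turn entered horizontally or a left turn entered vertically. [cite: GlazmanManolescu2019, §1, Fig. 1] -/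
theorem arcKind_eq_coCorner_iff (s t : Side) : arcKind s t = .coCorner ↔ (isHR (s, t) = true ∨ isVL (s, t) = true) := by
  cases s <;> cases t <;> decide

/-- A `θ`-corner arc is a left turn entered horizontally or a right turn entered vertically. [cite: GlazmanManolescu2019, §1, Fig. 1] -/
theorem arcKind_eq_corner_iff (s t : Side) : arcKind s t = .corner ↔ (isHL (s, t) = true ∨ isVR (s, t) = true) := by
  cases s <;> cases t <;> decide

/-- The four classes are pairwise disjoint (the four pairs used below). [cite: GlazmanManolescu2019, §1, Fig. 1 (lane plumbing)] -/
theorem classes_disjoint (st : Side × Side) :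
    ¬(isHR st = true ∧ isVL st = true) ∧ ¬(isHL st = true ∧ isVR st = true) ∧
      ¬(isHL st = true ∧ isHR st = true) ∧ ¬(isVL st = true ∧ isVR st = true) := by
  obtain ⟨s, t⟩ := st
  cases s <;> cases t <;> decide

/-- THE DATA OF AN ARC: either it is drawn in no rhombus (no sides, no kind, no turn), or it joins two distinct sides `s ≠ t` of a
rhombus, with `arcSides = (s, t)`, kind `arcKind s t` and quarter turn `qTurn s t`. [cite: GlazmanManolescu2019, §1, Fig. 1 (lane plumbing)] -/
theorem arc_data (p : MidEdge × MidEdge) :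
    (arcSides p = none ∧ arcKindOf p = none ∧ qTurnOf p = 0) ∨
      ∃ s t : Side, s ≠ t ∧ arcSides p = some (s, t) ∧ arcKindOf p = some (arcKind s t) ∧ qTurnOf p = qTurn s t := by
  cases h : arcFace p with
  | none =>
    left
    refine ⟨by simp [arcSides, h], by simp [arcKindOf, h], by simp [qTurnOf, h]⟩
  | some f =>
    right
    obtain ⟨s, t, hst, hs, ht, hk⟩ := exists_sides_of_arcFace h
    refine ⟨s, t, hst, ?_, hk, ?_⟩
    · simp only [arcSides, h, Option.bind_some, ← hs, ← ht, Face.sideOf_side]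
    · simp only [qTurnOf, h, ← hs, ← ht, Face.sideOf_side]

end ArcClasses

/-! ## The quarter-turn count and the corner counts as class counts (any mid-edge list) -/

section ListIdentities

/-- The class indicators of an arc, as natural numbers `0/1`. [cite: GlazmanManolescu2019, §1, Fig. 1 (lane plumbing)] -/
private def ind (c : Side × Side → Bool) (p : MidEdge × MidEdge) : ℕ := if (arcSides p).elim false c = true then 1 else 0

/-- `countP` of a class over a list of arcs as a sum of indicators. [folklore] -/
private theorem countP_eq_sum_ind (c : Side × Side → Bool) (A : List (MidEdge × MidEdge)) :
    A.countP (fun p => (arcSides p).elim false c) = (A.map (ind c)).sum := by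
  induction A with
  | nil => simp
  | cons p A ih =>
    rw [List.countP_cons, List.map_cons, List.sum_cons, ih]
    unfold ind
    split_ifs <;> omega

/-- The quarter turn of one arc in terms of its class indicators. [cite: GlazmanManolescu2019, §2.1 (lane plumbing)] -/
private theorem qTurnOf_eq_ind (p : MidEdge × MidEdge) :
    qTurnOf p = (ind isHL p : ℤ) + ind isVL p - ind isHR p - ind isVR p := by
  rcases arc_data p with ⟨hs, -, hq⟩ | ⟨s, t, -, hs, -, hq⟩
  · simp [ind, hs, hq]
  · rw [hq, qTurn_eq_classes]
    simp only [ind, hs, Option.elim_some]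
    cases isHL (s, t) <;> cases isVL (s, t) <;> cases isHR (s, t) <;> cases isVR (s, t) <;> simp

/-- ★ **THE QUARTER-TURN COUNT BY CLASSES**: `q(l) = n_{HL} + n_{VL} − n_{HR} − n_{VR}` for every mid-edge list.
[cite: GlazmanManolescu2019, §2.1 (the winding `e^{−iσ·wind}` of a walk; lane plumbing)] -/
theorem quarterTurnsL_eq_classes (l : List MidEdge) :
    quarterTurnsL l = (hlCount l : ℤ) + vlCount l - hrCount l - vrCount l := by
  unfold quarterTurnsL hlCount vlCount hrCount vrCount classCount
  rw [countP_eq_sum_ind, countP_eq_sum_ind, countP_eq_sum_ind, countP_eq_sum_ind]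
  induction arcsOf l with
  | nil => simp
  | cons p A ih =>
    simp only [List.map_cons, List.sum_cons, Nat.cast_add] at ih ⊢
    rw [qTurnOf_eq_ind p]
    push_cast at ih ⊢
    linarith

/-- The co-corner indicator of one arc is the sum of its `HR` and `VL` indicators. [cite: GlazmanManolescu2019, §1, Fig. 1] -/
private theorem coCorner_ind (p : MidEdge × MidEdge) :
    (if arcKindOf p = some .coCorner then 1 else 0) = ind isHR p + ind isVL p := by
  rcases arc_data p with ⟨hs, hk, -⟩ | ⟨s, t, -, hs, hk, -⟩
  · simp [ind, hs, hk]
  · have hd := (classes_disjoint (s, t)).1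
    have hiff := arcKind_eq_coCorner_iff s t
    simp only [ind, hs, hk, Option.elim_some, Option.some.injEq]
    revert hd hiff
    cases isHR (s, t) <;> cases isVL (s, t) <;> cases arcKind s t <;> simp

/-- The corner indicator of one arc is the sum of its `HL` and `VR` indicators. [cite: GlazmanManolescu2019, §1, Fig. 1] -/
private theorem corner_ind (p : MidEdge × MidEdge) :
    (if arcKindOf p = some .corner then 1 else 0) = ind isHL p + ind isVR p := by
  rcases arc_data p with ⟨hs, hk, -⟩ | ⟨s, t, -, hs, hk, -⟩
  · simp [ind, hs, hk]
  · have hd := (classes_disjoint (s, t)).2.1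
    have hiff := arcKind_eq_corner_iff s t
    simp only [ind, hs, hk, Option.elim_some, Option.some.injEq]
    revert hd hiff
    cases isHL (s, t) <;> cases isVR (s, t) <;> cases arcKind s t <;> simp

/-- ★ **THE NUMBER OF `(π−θ)`-CORNER ARCS is `n_{HR} + n_{VL}`.** [cite: GlazmanManolescu2019, §1, Fig. 1] -/
theorem countP_coCorner_eq (l : List MidEdge) :
    (arcsOf l).countP (fun p => arcKindOf p = some .coCorner) = hrCount l + vlCount l := by
  unfold hrCount vlCount classCount
  rw [countP_eq_sum_ind, countP_eq_sum_ind]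
  induction arcsOf l with
  | nil => simp
  | cons p A ih =>
    rw [List.countP_cons, List.map_cons, List.map_cons, List.sum_cons, List.sum_cons, ih]
    have := coCorner_ind p
    simp only [decide_eq_true_eq] at this ⊢
    omega

/-- ★ **THE NUMBER OF `θ`-CORNER ARCS is `n_{HL} + n_{VR}`.** [cite: GlazmanManolescu2019, §1, Fig. 1] -/
theorem countP_corner_eq (l : List MidEdge) :
    (arcsOf l).countP (fun p => arcKindOf p = some .corner) = hlCount l + vrCount l := by
  unfold hlCount vrCount classCount
  rw [countP_eq_sum_ind, countP_eq_sum_ind]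
  induction arcsOf l with
  | nil => simp
  | cons p A ih =>
    rw [List.countP_cons, List.map_cons, List.map_cons, List.sum_cons, List.sum_cons, ih]
    have := corner_ind p
    simp only [decide_eq_true_eq] at this ⊢
    omega

end ListIdentities

/-! ## From arcs to plaquettes: the corner counts of a walk in terms of `n_{u}`, `n_{w}` -/

section FaceAccounting

variable {D : Set Face} {a z : MidEdge}

/-- Counting through a `filterMap`. [folklore] -/
private theorem countP_filterMap'' {α β : Type*} (g : α → Option β) (q : β → Bool) (A : List α) :
    (A.filterMap g).countP q = A.countP fun x => (g x).elim false q := by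
  induction A with
  | nil => simp
  | cons x A ih =>
    rw [List.filterMap_cons, List.countP_cons]
    cases hx : g x with
    | none => simp [ih]
    | some b => rw [List.countP_cons, ih]; simp

/-- A Kronecker sum over a duplicate-free list picks out one term. [folklore] -/
private theorem sum_map_ite_eq_of_nodup' {β : Type*} [DecidableEq β] (F : List β) (hF : F.Nodup) {f₀ : β} (h : f₀ ∈ F) :
    (F.map fun f => if f₀ = f then 1 else 0).sum = 1 := by
  have e : ∀ F : List β, (F.map fun f => if f₀ = f then 1 else 0).sum = F.count f₀ := by
    intro F
    induction F with
    | nil => simp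
    | cons f F ih =>
      rw [List.map_cons, List.sum_cons, ih, List.count_cons]
      by_cases hf : f = f₀
      · subst hf; simp [add_comm]
      · have : ¬f₀ = f := fun e => hf e.symm
        simp [hf, this]
  rw [e, List.count_eq_one_of_mem hF h]

/-- Fibrewise counting (as in `PlaquetteWalkAngleCostParity`): summing over a duplicate-free list of faces the number of arcs with a
property lying in each face gives the number of all arcs with the property, if every such arc lies in a listed face. [folklore] -/
private theorem sum_map_countP_fibre' {α β : Type*} [DecidableEq β] (φ : α → Option β) (P : α → Bool) (F : List β)
    (hF : F.Nodup) :
    ∀ A : List α, (∀ p ∈ A, P p = true → ∃ f ∈ F, φ p = some f) →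
      (F.map fun f => A.countP fun p => decide (φ p = some f) && P p).sum = A.countP P
  | [], _ => by simp
  | p :: A, hA => by
    have hA' : ∀ q ∈ A, P q = true → ∃ f ∈ F, φ q = some f := fun q hq => hA q (List.mem_cons_of_mem _ hq)
    have ih := sum_map_countP_fibre' φ P F hF A hA'
    simp only [List.countP_cons]
    have split : (F.map fun f => (A.countP fun p => decide (φ p = some f) && P p) +
        if (decide (φ p = some f) && P p) = true then 1 else 0).sum =
        (F.map fun f => A.countP fun p => decide (φ p = some f) && P p).sum +
          (F.map fun f => if (decide (φ p = some f) && P p) = true then 1 else 0).sum := by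
      rw [← List.sum_map_add]
    rw [split, ih]
    congr 1
    by_cases hp : P p = true
    · obtain ⟨f₀, hf₀, hφ⟩ := hA p List.mem_cons_self hp
      rw [if_pos hp]
      have e : (F.map fun f => if (decide (φ p = some f) && P p) = true then 1 else 0) =
          F.map fun f => if f₀ = f then 1 else 0 := by
        refine List.map_congr_left fun f _ => ?_
        by_cases h : f₀ = f
        · subst h; simp [hφ, hp]
        · have : φ p ≠ some f := by rw [hφ]; exact fun e => h (Option.some_injective _ e)
          simp [this, h]
      rw [e, sum_map_ite_eq_of_nodup' F hF hf₀]
    · rw [if_neg hp]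
      have e : (F.map fun f => if (decide (φ p = some f) && P p) = true then 1 else 0) = F.map fun _ => 0 := by
        refine List.map_congr_left fun f _ => ?_
        simp [hp]
      rw [e]; simp

/-- The number of arcs of kind `κ` drawn in the face `f` is the number of entries `κ` of the kinds list of `f`.
[cite: GlazmanManolescu2019, §1, Fig. 1 (lane plumbing)] -/
private theorem countP_face_kind_eq_count (l : List MidEdge) (f : Face) (κ : ArcKind) :
    ((arcsOf l).countP fun p => decide (arcFace p = some f) && decide (arcKindOf p = some κ)) = (kindsL l f).count κ := by
  unfold kindsL
  rw [List.count, countP_filterMap'']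
  refine List.countP_congr fun p _ => ?_
  by_cases h : arcFace p = some f
  · rw [if_pos h]
    cases hk : arcKindOf p with
    | none => simp [h]
    | some k => simp [h]
  · rw [if_neg h]; simp [h]

/-- ★ **ARCS TO PLAQUETTES, EXACTLY**: the number of arcs of kind `κ` of a walk is the sum over its visited plaquettes of the number of
entries `κ` of their kinds lists. [cite: GlazmanManolescu2019, §1 ("the weight of a walk is the product of weights associated to each rhombus")] -/
theorem countP_kind_eq_sum_faces (γ : YBWalk D a z) (κ : ArcKind) :
    (arcsOf γ.mids).countP (fun p => arcKindOf p = some κ) = ((facesL γ.mids).map fun f => (kindsL γ.mids f).count κ).sum := by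
  classical
  have hF : (facesL γ.mids).Nodup := List.nodup_dedup _
  have hcov : ∀ p ∈ arcsOf γ.mids, decide (arcKindOf p = some κ) = true → ∃ f ∈ facesL γ.mids, arcFace p = some f := by
    intro p hp _
    obtain ⟨f, -, hpf⟩ := γ.arc_mem p hp
    refine ⟨f, ?_, hpf⟩
    unfold facesL
    rw [List.mem_dedup, List.mem_filterMap]
    exact ⟨p, hp, hpf⟩
  have key := sum_map_countP_fibre' arcFace (fun p => decide (arcKindOf p = some κ)) (facesL γ.mids) hF (arcsOf γ.mids) hcov
  rw [← key]
  congr 1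
  exact List.map_congr_left fun f _ => countP_face_kind_eq_count γ.mids f κ

/-- Summing `A f + 2·B f` over a list for two disjoint decidable predicates. [folklore] -/
private theorem sum_map_ite_add_two {β : Type*} (F : List β) (A B : β → Prop) [DecidablePred A] [DecidablePred B]
    (h : ∀ f, ¬(A f ∧ B f)) :
    (F.map fun f => (if A f then 1 else 0) + 2 * (if B f then 1 else 0)).sum =
      F.countP (fun f => decide (A f)) + 2 * F.countP (fun f => decide (B f)) := by
  induction F with
  | nil => simp
  | cons f F ih =>
    rw [List.map_cons, List.sum_cons, ih, List.countP_cons, List.countP_cons]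
    by_cases hA : A f <;> by_cases hB : B f
    · exact absurd ⟨hA, hB⟩ (h f)
    · simp [hA, hB]; omega
    · simp [hA, hB]; omega
    · simp [hA, hB]

/-- ★★ **THE `(π−θ)`-CORNER ARCS OF A WALK NUMBER `n_{u₂} + 2n_{w₂}`** (one per `u₂`-plaquette, two per `w₂`-plaquette; the local
configurations are those of Fig. 1). [cite: GlazmanManolescu2019, §1, Fig. 1 and eq. (1)] -/
theorem countP_coCorner_eq_cfgCount (γ : YBWalk D a z) :
    (arcsOf γ.mids).countP (fun p => arcKindOf p = some .coCorner) =
      cfgCount γ.mids [.coCorner] + 2 * cfgCount γ.mids [.coCorner, .coCorner] := by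
  classical
  rw [countP_kind_eq_sum_faces γ .coCorner]
  have e : ((facesL γ.mids).map fun f => (kindsL γ.mids f).count ArcKind.coCorner) =
      (facesL γ.mids).map fun f => (if kindsL γ.mids f = [.coCorner] then 1 else 0) +
        2 * (if kindsL γ.mids f = [.coCorner, .coCorner] then 1 else 0) := by
    refine List.map_congr_left fun f _ => ?_
    rcases kindsL_shape γ f with h | h | h | h | h | h <;> rw [h] <;> simp
  rw [e, sum_map_ite_add_two _ _ _ (fun f hf => by rw [hf.1] at hf; exact absurd hf.2 (by decide))]
  rfl

/-- ★★ **THE `θ`-CORNER ARCS OF A WALK NUMBER `n_{u₁} + 2n_{w₁}`.** [cite: GlazmanManolescu2019, §1, Fig. 1 and eq. (1)] -/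
theorem countP_corner_eq_cfgCount (γ : YBWalk D a z) :
    (arcsOf γ.mids).countP (fun p => arcKindOf p = some .corner) =
      cfgCount γ.mids [.corner] + 2 * cfgCount γ.mids [.corner, .corner] := by
  classical
  rw [countP_kind_eq_sum_faces γ .corner]
  have e : ((facesL γ.mids).map fun f => (kindsL γ.mids f).count ArcKind.corner) =
      (facesL γ.mids).map fun f => (if kindsL γ.mids f = [.corner] then 1 else 0) +
        2 * (if kindsL γ.mids f = [.corner, .corner] then 1 else 0) := by
    refine List.map_congr_left fun f _ => ?_
    rcases kindsL_shape γ f with h | h | h | h | h | h <;> rw [h] <;> simp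
  rw [e, sum_map_ite_add_two _ _ _ (fun f hf => by rw [hf.1] at hf; exact absurd hf.2 (by decide))]
  rfl

/-- ★★ **THE TURN BOOKKEEPING OF A WALK**: `n_{u₂} + 2n_{w₂} = n_{HR} + n_{VL}`, `n_{u₁} + 2n_{w₁} = n_{HL} + n_{VR}` and
`q = n_{HL} + n_{VL} − n_{HR} − n_{VR}`; hence `q + 2(n_{u₂} + 2n_{w₂}) = (n_{HL} + n_{HR}) − (n_{VL} + n_{VR}) + 4n_{VL}`.
[cite: GlazmanManolescu2019, §1, Fig. 1 and eq. (1); §2.1 (the winding)] -/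
theorem quarterTurnsL_add_two_coCorner (γ : YBWalk D a z) :
    quarterTurnsL γ.mids + 2 * ((cfgCount γ.mids [.coCorner] : ℤ) + 2 * cfgCount γ.mids [.coCorner, .coCorner]) =
      ((hlCount γ.mids : ℤ) + hrCount γ.mids) - (vlCount γ.mids + vrCount γ.mids) + 4 * vlCount γ.mids := by
  have h1 := countP_coCorner_eq_cfgCount γ
  rw [countP_coCorner_eq] at h1
  rw [quarterTurnsL_eq_classes]
  have h1' : ((hrCount γ.mids : ℤ) + vlCount γ.mids) = cfgCount γ.mids [.coCorner] + 2 * cfgCount γ.mids [.coCorner, .coCorner] := by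
    exact_mod_cast h1
  linarith

end FaceAccounting

/-! ## Horizontal and vertical entries: the telescoping count `n_{H→V} − n_{V→H}` -/

section Telescoping

/-- The number of arcs entered through a vertical side and left through a slanted one (`H → V` turns), read off the mid-edges.
[cite: GlazmanManolescu2019, §1 (the tiling; lane plumbing)] -/
def hvCount (l : List MidEdge) : ℕ := (arcsOf l).countP fun p => vertB p.1 && !vertB p.2

/-- The number of arcs entered through a slanted side and left through a vertical one (`V → H` turns).
[cite: GlazmanManolescu2019, §1 (the tiling; lane plumbing)] -/
def vhCount (l : List MidEdge) : ℕ := (arcsOf l).countP fun p => !vertB p.1 && vertB p.2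

/-- `arcsOf` of a list with at least two entries. [folklore] -/
private theorem arcsOf_cons_cons' (x y : MidEdge) (l : List MidEdge) : arcsOf (x :: y :: l) = (x, y) :: arcsOf (y :: l) := rfl

/-- ★ **TELESCOPING**: `n_{H→V} − n_{V→H} = [first mid-edge vertical] − [last mid-edge vertical]` for every non-empty mid-edge list.
[cite: GlazmanManolescu2019, §1 (the tiling; lane plumbing)] -/
theorem hvCount_sub_vhCount (x : MidEdge) (l : List MidEdge) :
    (hvCount (x :: l) : ℤ) - vhCount (x :: l) =
      (if vertB x then 1 else 0) - (if vertB ((x :: l).getLast (List.cons_ne_nil x l)) then 1 else 0) := by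
  induction l generalizing x with
  | nil => cases hx : vertB x <;> simp [hvCount, vhCount, arcsOf, hx]
  | cons y l ih =>
    have key := ih y
    unfold hvCount vhCount at key ⊢
    rw [arcsOf_cons_cons', List.countP_cons, List.countP_cons, List.getLast_cons (List.cons_ne_nil y l)]
    push_cast
    cases hx : vertB x <;> cases hy : vertB y <;> simp [hy] at key ⊢ <;> linarith

/-- The sides `W`, `E` are the vertical ones: for an arc joining the sides `s`, `t` of a rhombus, `H → V` means `s ∈ {W, E}`,
`t ∈ {S, N}`, which is `isHL ∨ isHR`; `V → H` is `isVL ∨ isVR`. [cite: GlazmanManolescu2019, §1, Fig. 4] -/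
private theorem hv_vh_of_sides (f : Face) (s t : Side) :
    (vertB (f.side s) && !vertB (f.side t)) = (isHL (s, t) || isHR (s, t)) ∧
      (!vertB (f.side s) && vertB (f.side t)) = (isVL (s, t) || isVR (s, t)) := by
  obtain ⟨hW, hE, hS, hN⟩ := vertB_side f
  cases s <;> cases t <;> simp [hW, hE, hS, hN, isHL, isHR, isVL, isVR]

/-- Disjoint booleans: the indicator of `x ∨ y` is the sum of the indicators. [folklore] -/
private theorem ite_or_eq_add {x y : Bool} (h : ¬(x = true ∧ y = true)) :
    (if (x || y) = true then 1 else 0 : ℕ) = (if x = true then 1 else 0) + (if y = true then 1 else 0) := by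
  cases x <;> cases y <;> simp_all

variable {D : Set Face} {a z : MidEdge}

/-- ★ For a walk, **`n_{H→V} = n_{HL} + n_{HR}` and `n_{V→H} = n_{VL} + n_{VR}`** (every arc lies in a rhombus of the domain).
[cite: GlazmanManolescu2019, §1, Fig. 1 and Fig. 4] -/
theorem hvCount_eq (γ : YBWalk D a z) :
    hvCount γ.mids = hlCount γ.mids + hrCount γ.mids ∧ vhCount γ.mids = vlCount γ.mids + vrCount γ.mids := by
  unfold hvCount vhCount hlCount hrCount vlCount vrCount classCount
  have main : ∀ A : List (MidEdge × MidEdge), (∀ p ∈ A, ∃ f ∈ D, arcFace p = some f) →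
      (A.countP fun p => vertB p.1 && !vertB p.2) =
          (A.countP fun p => (arcSides p).elim false isHL) + (A.countP fun p => (arcSides p).elim false isHR) ∧
        (A.countP fun p => !vertB p.1 && vertB p.2) =
          (A.countP fun p => (arcSides p).elim false isVL) + (A.countP fun p => (arcSides p).elim false isVR) := by
    intro A hA
    induction A with
    | nil => simp
    | cons p A ih =>
      have hA' : ∀ q ∈ A, ∃ f ∈ D, arcFace q = some f := fun q hq => hA q (List.mem_cons_of_mem _ hq)
      obtain ⟨ih1, ih2⟩ := ih hA'
      obtain ⟨f, -, hpf⟩ := hA p List.mem_cons_self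
      obtain ⟨s, t, hst, hs, ht, -⟩ := exists_sides_of_arcFace hpf
      have hsd : arcSides p = some (s, t) := by
        simp only [arcSides, hpf, Option.bind_some, ← hs, ← ht, Face.sideOf_side]
      obtain ⟨e1, e2⟩ := hv_vh_of_sides f s t
      rw [hs, ht] at e1 e2
      obtain ⟨-, -, hdH, hdV⟩ := classes_disjoint (s, t)
      rw [List.countP_cons, List.countP_cons, List.countP_cons, List.countP_cons, List.countP_cons, List.countP_cons,
        ih1, ih2, e1, e2]
      simp only [hsd, Option.elim_some]
      rw [ite_or_eq_add hdH, ite_or_eq_add hdV]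
      constructor <;> omega
  exact main _ γ.arc_mem

/-- ★★ **FOR A WALK, `n_{H→V} − n_{V→H} = [a vertical] − [z vertical]`** (`0` or `±1`). [cite: GlazmanManolescu2019, §1 (the tiling)] -/
theorem hvCount_sub_vhCount_walk (γ : YBWalk D a z) :
    (hvCount γ.mids : ℤ) - vhCount γ.mids = (if vertB a then 1 else 0) - (if vertB z then 1 else 0) := by
  obtain ⟨rest, hl⟩ : ∃ rest, γ.mids = a :: rest := by
    cases hm : γ.mids with
    | nil => have := γ.head_eq; rw [hm] at this; simp at this
    | cons x rest => have := γ.head_eq; rw [hm] at this; simp at this; exact ⟨rest, by rw [this]⟩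
  have hlast : (a :: rest).getLast (List.cons_ne_nil a rest) = z := by
    have := γ.getLast_eq; rw [hl, List.getLast?_eq_getLast_of_ne_nil (List.cons_ne_nil a rest)] at this
    simpa using this
  rw [hl, hvCount_sub_vhCount a rest, hlast]

end Telescoping

/-! ## The phase law -/

section PhaseLaw

/-- `ζ³² = 1` in the form `ζ^{a + 32b} = ζ^a`. [cite: GlazmanManolescu2019, §1, eq. (1) (lane plumbing: cyclotomic arithmetic)] -/
theorem zeta32_pow_add_mul (a b : ℕ) : zeta32 ^ (a + 32 * b) = zeta32 ^ a := by
  rw [pow_add, pow_mul, zeta32_pow_thirtyTwo, one_pow, mul_one]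

/-- `−ζ⁶ = ζ²²` and `−ζ⁴ = ζ²⁰`. [cite: GlazmanManolescu2019, §1, eq. (1) (lane plumbing)] -/
private theorem neg_zeta32_pow_six_four : -zeta32 ^ 6 = zeta32 ^ 22 ∧ -zeta32 ^ 4 = zeta32 ^ 20 := by
  constructor
  · rw [show (22 : ℕ) = 16 + 6 by norm_num, pow_add, zeta32_pow_sixteen]; ring
  · rw [show (20 : ℕ) = 16 + 4 by norm_num, pow_add, zeta32_pow_sixteen]; ring

/-- `(ζ²⁷)^{−k} = ζ^{5k}` (`ζ²⁷·ζ⁵ = 1`). [cite: GlazmanManolescu2019, §1, eq. (1) (lane plumbing)] -/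
private theorem zeta32_pow27_zpow_neg (k : ℕ) : (zeta32 ^ 27) ^ (-(k : ℤ)) = zeta32 ^ (5 * k) := by
  have hinv : (zeta32 ^ 27)⁻¹ = zeta32 ^ 5 :=
    inv_eq_of_mul_eq_one_right (by rw [← pow_add]; exact zeta32_pow_thirtyTwo)
  rw [zpow_neg, zpow_natCast, ← inv_pow, hinv, ← pow_mul]

/-- THE EXPONENT ALGEBRA of the phase law (abstract form): with `q = E + 4v − 2n₂ − 4n_{w₂}`,
`ζ^e (ζ²⁷)^q (ζ⁴+ζ¹²)^{n₁} ((ζ⁴+ζ¹²)(−ζ⁶))^{n₂} (ζ¹²)^{n_{w₁}} (−ζ⁴)^{n_{w₂}} = (ζ⁴+ζ¹²)^{n₁+n₂} (ζ²⁷)^E ζ^{e + 12(v + n_{w₁}) + 8n_{w₂}}`.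
[cite: GlazmanManolescu2019, §1, eq. (1) (lane plumbing: cyclotomic arithmetic)] -/
private theorem phase_algebra (S : ℂ) (e : ℕ) (E q : ℤ) (n1 n2 nw1 nw2 v : ℕ)
    (hq : q = E + 4 * (v : ℤ) - 2 * n2 - 4 * nw2) :
    S * zeta32 ^ e * (zeta32 ^ 27) ^ q *
        ((zeta32 ^ 4 + zeta32 ^ 12) ^ n1 * ((zeta32 ^ 4 + zeta32 ^ 12) * -zeta32 ^ 6) ^ n2 *
          (zeta32 ^ 12) ^ nw1 * (-zeta32 ^ 4) ^ nw2) =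
      S * (zeta32 ^ 4 + zeta32 ^ 12) ^ (n1 + n2) * (zeta32 ^ 27) ^ E * zeta32 ^ (e + 12 * (v + nw1) + 8 * nw2) := by
  obtain ⟨h6, h4⟩ := neg_zeta32_pow_six_four
  have hu : zeta32 ^ 27 ≠ 0 := pow_ne_zero _ zeta32_ne_zero
  -- split the integer power
  have hsplit : (zeta32 ^ 27) ^ q = (zeta32 ^ 27) ^ E * zeta32 ^ (108 * v) * zeta32 ^ (5 * (2 * n2 + 4 * nw2)) := by
    rw [hq, show E + 4 * (v : ℤ) - 2 * n2 - 4 * nw2 = E + ((4 * v : ℕ) : ℤ) + -(((2 * n2 + 4 * nw2 : ℕ) : ℤ)) by push_cast; ring,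
      zpow_add₀ hu, zpow_add₀ hu, zeta32_pow27_zpow_neg, zpow_natCast, ← pow_mul, show 27 * (4 * v) = 108 * v by ring]
  rw [hsplit, mul_pow, h6, h4, ← pow_mul, ← pow_mul, ← pow_mul, pow_add]
  -- collect the powers of `ζ`
  have key : zeta32 ^ e * (zeta32 ^ (108 * v) * zeta32 ^ (5 * (2 * n2 + 4 * nw2))) *
      (zeta32 ^ (22 * n2) * zeta32 ^ (12 * nw1) * zeta32 ^ (20 * nw2)) = zeta32 ^ (e + 12 * (v + nw1) + 8 * nw2) := by
    rw [← pow_add, ← pow_add, ← pow_add, ← pow_add, ← pow_add,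
      show e + (108 * v + 5 * (2 * n2 + 4 * nw2)) + (22 * n2 + 12 * nw1 + 20 * nw2) =
        (e + 12 * (v + nw1) + 8 * nw2) + 32 * (3 * v + n2 + nw2) by ring, zeta32_pow_add_mul]
  rw [← key]
  ring

/-- `ζ^{27d} · ζ^{5d + N} = ζ^N`. [cite: GlazmanManolescu2019, §1, eq. (1) (lane plumbing)] -/
private theorem zeta32_pow_27_mul_5 (d N M : ℕ) : zeta32 ^ (27 * d) * zeta32 ^ (5 * d + N + M) = zeta32 ^ (N + M) := by
  rw [← pow_add, show 27 * d + (5 * d + N + M) = (N + M) + 32 * d by ring, zeta32_pow_add_mul]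

variable {D : Set Face} {a z : MidEdge}

/-- The quarter-turn count of a walk in the form used by the phase law: `q = (n_{H→V} − n_{V→H}) + 4n_{VL} − 2n_{u₂} − 4n_{w₂}`.
[cite: GlazmanManolescu2019, §1, Fig. 1 and eq. (1); §2.1] -/
theorem quarterTurnsL_eq_hv_sub_vh (γ : YBWalk D a z) :
    quarterTurnsL γ.mids = ((hvCount γ.mids : ℤ) - vhCount γ.mids) + 4 * vlCount γ.mids -
      2 * cfgCount γ.mids [.coCorner] - 4 * cfgCount γ.mids [.coCorner, .coCorner] := by
  have h := quarterTurnsL_add_two_coCorner γ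
  obtain ⟨h1, h2⟩ := hvCount_eq γ
  rw [h1, h2]; push_cast
  linarith

/-- ★★★ **THE PHASE LAW OF THE `Z → ∞` LIMIT MODEL.** For every walk `γ` of the Yang–Baxter model and every slot `s`,
`limitWeight_s(γ) = slotSign s · (ζ⁴ + ζ¹²)^{n_{u₁}+n_{u₂}} · (ζ²⁷)^{n_{H→V} − n_{V→H}} · ζ^{slotExp s + 12(n_{VL} + n_{w₁}) + 8 n_{w₂}}`
(`ζ = e^{iπ/16}`, `ζ⁴ + ζ¹² = i√2`): apart from the magnitude `(√2)^{n_{u₁}+n_{u₂}}` and the slot, the limit weight of a walk is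
the EIGHTH root of unity `ζ₈^{3(n_{VL} + n_{w₁}) + 2n_{w₂}}` — it depends only on the number `n_{VL}` of left turns entered
vertically (arcs `S → W`, `N → E`) plus the number of `w₁`-plaquettes, modulo `8`, and on the number of `w₂`-plaquettes modulo
`4` (and on `n_{H→V} − n_{V→H} ∈ {0, ±1}`, fixed by the orientations of the root and of the end).
[cite: GlazmanManolescu2019, §1, Fig. 1 and eq. (1); Lemma 2.1, eq. (CR); §2.1, eq. (2.1)] -/
theorem limitWeight_eq_phase (γ : YBWalk D a z) (s : Fin 4) :
    limitWeight s γ.mids = slotSign s * (zeta32 ^ 4 + zeta32 ^ 12) ^ (cfgCount γ.mids [.corner] + cfgCount γ.mids [.coCorner]) *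
      (zeta32 ^ 27) ^ ((hvCount γ.mids : ℤ) - vhCount γ.mids) *
        zeta32 ^ (slotExp s + 12 * (vlCount γ.mids + cfgCount γ.mids [.corner, .corner]) +
          8 * cfgCount γ.mids [.coCorner, .coCorner]) := by
  rw [limitWeight_eq_zeta32]
  exact phase_algebra (slotSign s) (slotExp s) _ _ _ _ _ _ _ (by have := quarterTurnsL_eq_hv_sub_vh γ; linarith)

/-- ★★★ **THE PHASE LAW FROM A VERTICAL ROOT** (the hole roots `w.side W` of the lane): for a walk from a vertical mid-edge to
the slot `s` of `f₀`, `n_{H→V} − n_{V→H} = slotDeg s` cancels the slot unit (`ζ⁵·ζ²⁷ = 1`), and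
`limitWeight_s(γ) = slotSign s · (ζ⁴ + ζ¹²)^{n_{u₁}+n_{u₂}} · ζ^{12(n_{VL} + n_{w₁}) + 8n_{w₂}}`:
the limit weight is `± (i√2)^{n_{u₁}+n_{u₂}} · ζ₈^{3(n_{VL}+n_{w₁}) + 2n_{w₂}}`.
[cite: GlazmanManolescu2019, §1, Fig. 1 and eq. (1); Lemma 2.1, eq. (CR); §2.1, eq. (2.1)] -/
theorem limitWeight_eq_phase_of_vert (Dl : List Face) {a : MidEdge} (ha : vertB a = true) (f₀ : Face) (s : Fin 4)
    (γ : YBWalk (dom Dl) a (slotSide f₀ s)) :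
    limitWeight s γ.mids = slotSign s * (zeta32 ^ 4 + zeta32 ^ 12) ^ (cfgCount γ.mids [.corner] + cfgCount γ.mids [.coCorner]) *
      zeta32 ^ (12 * (vlCount γ.mids + cfgCount γ.mids [.corner, .corner]) + 8 * cfgCount γ.mids [.coCorner, .coCorner]) := by
  rw [limitWeight_eq_phase γ s]
  have hE : (hvCount γ.mids : ℤ) - vhCount γ.mids = slotDeg s := by
    rw [hvCount_sub_vhCount_walk γ, ha, vertB_slotSide]
    unfold slotDeg; fin_cases s <;> simp
  have hslot : slotExp s = 5 * slotDeg s := by unfold slotExp slotDeg; fin_cases s <;> simp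
  rw [hE, hslot, zpow_natCast, ← pow_mul, mul_assoc _ (zeta32 ^ (27 * slotDeg s)), zeta32_pow_27_mul_5]

end PhaseLaw

/-! ## The wound limit SUM and the half-plane criterion -/

section HalfPlane

variable (Dl : List Face) (a : MidEdge) (f₀ : Face)

/-- The budget bounds every labelled walk at `f₀`. [folklore] -/
private theorem totalExp_le_of_maxExp_le'' {K : ℕ} (hK : maxExp Dl a f₀ ≤ K) (ω : ΩG (dom Dl) a f₀) :
    totalExp ω.2.mids ≤ K := by
  obtain ⟨z, γ⟩ := ω
  have e : f₀.side z = slotSide f₀ (slotOfSide z) := (slotSide_slotOfSide_eq f₀ z).symm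
  have h1 : totalExp γ.mids ≤ maxExpTo Dl a (f₀.side z) :=
    Finset.le_sup (f := fun γ : YBWalk (dom Dl) a (f₀.side z) => totalExp γ.mids) (Finset.mem_univ γ)
  have h2 : maxExpTo Dl a (slotSide f₀ (slotOfSide z)) ≤ maxExp Dl a f₀ :=
    Finset.le_sup (f := fun s : Fin 4 => maxExpTo Dl a (slotSide f₀ s)) (Finset.mem_univ (slotOfSide z))
  rw [← e] at h2
  exact h1.trans (h2.trans hK)

open Classical in
/-- ★ **THE WOUND LIMIT SUM at level `j`**: the sum of the LIMIT WEIGHTS (no power of `lead(Z²·Den)`) of the wound group members of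
cost exactly `j` — the level-`j` partition function of the wound walks in the `Z → ∞` limit model.
[cite: GlazmanManolescu2019, Lemma 2.1 (proof: the groups) and eq. (1)] -/
def woundLimitSum (hr : RootedFace (dom Dl) a f₀) (j : ℕ) : ℂ :=
  ∑ ω ∈ (ΩG.setB2a (dom Dl) a f₀).filter (fun ω => ¬ω.Unwound hr),
    ((if cost (slotOfSide ω.1) ω.2.mids = j then limitWeight (slotOfSide ω.1) ω.2.mids else 0) +
      (if IsNS ω hr ∧ cost (slotOfSide (ω.ext₃ hr).1) (ω.ext₃ hr).2.mids = j then
        limitWeight (slotOfSide (ω.ext₃ hr).1) (ω.ext₃ hr).2.mids else 0))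

open Classical in
/-- ★ **`woundLimitCoeff_j = lead(Z²·Den)^K · woundLimitSum_j`.** [cite: GlazmanManolescu2019, Lemma 2.1 (proof: the groups) and eq. (1)] -/
theorem woundLimitCoeff_eq_mul_woundLimitSum (hr : RootedFace (dom Dl) a f₀) {K : ℕ} (hK : maxExp Dl a f₀ ≤ K) (j : ℕ) :
    woundLimitCoeff Dl a f₀ hr K j = ybDenPoly.leadingCoeff ^ K * woundLimitSum Dl a f₀ hr j := by
  unfold woundLimitCoeff woundLimitSum
  rw [Finset.mul_sum]
  refine Finset.sum_congr rfl fun ω _ => ?_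
  rw [mul_add]
  congr 1
  · split_ifs
    · exact leadingCoeff_termPoly_eq_limitWeight _ (totalExp_le_of_maxExp_le'' Dl a f₀ hK ω)
    · rw [mul_zero]
  · split_ifs
    · exact leadingCoeff_termPoly_eq_limitWeight _ (totalExp_le_of_maxExp_le'' Dl a f₀ hK (ω.ext₃ hr))
    · rw [mul_zero]

/-- The wound limit coefficient vanishes iff the wound limit sum does. [cite: GlazmanManolescu2019, Lemma 2.1 and eq. (1)] -/
theorem woundLimitCoeff_ne_zero_iff (hr : RootedFace (dom Dl) a f₀) {K : ℕ} (hK : maxExp Dl a f₀ ≤ K) (j : ℕ) :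
    woundLimitCoeff Dl a f₀ hr K j ≠ 0 ↔ woundLimitSum Dl a f₀ hr j ≠ 0 := by
  rw [woundLimitCoeff_eq_mul_woundLimitSum Dl a f₀ hr hK j, mul_ne_zero_iff]
  exact ⟨fun h => h.2, fun h => ⟨pow_ne_zero _ leadingCoeff_ybDenPoly_ne_zero, h⟩⟩

open Classical in
/-- ★★ **THE HALF-PLANE CRITERION.** If, for some complex direction `u`, every wound group member of cost `j` at `f₀` has a limit
weight with `Re(u · limitWeight) ≥ 0`, and at least one has `Re(u · limitWeight) > 0`, then the wound limit sum at level `j` is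
non-zero — no cancellation can occur among weights confined to a half-plane. [cite: GlazmanManolescu2019, Lemma 2.1 (proof: the groups) and eq. (1)] -/
theorem woundLimitSum_ne_zero_of_halfPlane (hr : RootedFace (dom Dl) a f₀) (j : ℕ) (u : ℂ)
    (hnn : ∀ ω ∈ (ΩG.setB2a (dom Dl) a f₀).filter (fun ω => ¬ω.Unwound hr),
      (cost (slotOfSide ω.1) ω.2.mids = j → 0 ≤ (u * limitWeight (slotOfSide ω.1) ω.2.mids).re) ∧
        (IsNS ω hr → cost (slotOfSide (ω.ext₃ hr).1) (ω.ext₃ hr).2.mids = j →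
          0 ≤ (u * limitWeight (slotOfSide (ω.ext₃ hr).1) (ω.ext₃ hr).2.mids).re))
    (hpos : ∃ ω ∈ (ΩG.setB2a (dom Dl) a f₀).filter (fun ω => ¬ω.Unwound hr),
      (cost (slotOfSide ω.1) ω.2.mids = j ∧ 0 < (u * limitWeight (slotOfSide ω.1) ω.2.mids).re) ∨
        (IsNS ω hr ∧ cost (slotOfSide (ω.ext₃ hr).1) (ω.ext₃ hr).2.mids = j ∧
          0 < (u * limitWeight (slotOfSide (ω.ext₃ hr).1) (ω.ext₃ hr).2.mids).re)) :
    woundLimitSum Dl a f₀ hr j ≠ 0 := by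
  set S := (ΩG.setB2a (dom Dl) a f₀).filter (fun ω => ¬ω.Unwound hr) with hS
  -- the real part of `u · Σ` is a sum of non-negative terms, one of them positive
  set g : ΩG (dom Dl) a f₀ → ℝ := fun ω =>
    (u * ((if cost (slotOfSide ω.1) ω.2.mids = j then limitWeight (slotOfSide ω.1) ω.2.mids else 0) +
      (if IsNS ω hr ∧ cost (slotOfSide (ω.ext₃ hr).1) (ω.ext₃ hr).2.mids = j then
        limitWeight (slotOfSide (ω.ext₃ hr).1) (ω.ext₃ hr).2.mids else 0))).re with hg
  have hg_nn : ∀ ω ∈ S, 0 ≤ g ω := by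
    intro ω hω
    obtain ⟨h1, h2⟩ := hnn ω hω
    simp only [hg, mul_add, Complex.add_re]
    refine add_nonneg ?_ ?_
    · split_ifs with hc
      · exact h1 hc
      · simp
    · split_ifs with hc
      · exact h2 hc.1 hc.2
      · simp
  have hre : (u * woundLimitSum Dl a f₀ hr j).re = ∑ ω ∈ S, g ω := by
    rw [woundLimitSum, ← hS, Finset.mul_sum, Complex.re_sum]
  have hlt : 0 < ∑ ω ∈ S, g ω := by
    obtain ⟨ω, hω, hp⟩ := hpos
    refine lt_of_lt_of_le ?_ (Finset.single_le_sum hg_nn hω)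
    obtain ⟨h1, h2⟩ := hnn ω hω
    simp only [hg, mul_add, Complex.add_re]
    rcases hp with ⟨hc, hp⟩ | ⟨hN, hc, hp⟩
    · rw [if_pos hc]
      refine add_pos_of_pos_of_nonneg hp ?_
      split_ifs with hc'
      · exact h2 hc'.1 hc'.2
      · simp
    · have hc2 : IsNS ω hr ∧ cost (slotOfSide (ω.ext₃ hr).1) (ω.ext₃ hr).2.mids = j := ⟨hN, hc⟩
      rw [if_pos hc2]
      refine add_pos_of_nonneg_of_pos ?_ hp
      split_ifs with hc'
      · exact h1 hc'
      · simp
  intro h0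
  rw [h0, mul_zero, Complex.zero_re] at hre
  linarith

open Classical in
/-- ★★★ **THE HALF-PLANE CRITERION FOR THE PRINTED VERTEX FUNCTIONAL AT A HOLE ROOT, LEVEL `5`.** For a finite domain `dom Dl`,
a `W`-normalised hole root `a = w.side W` (`(w.1 − 1, w.2) ∉ dom Dl`) and any rooted rhombus `f₀`: if for some complex direction
`u` every wound group member of cost `5` at `f₀` has `Re(u · limitWeight) ≥ 0` and one of them has `Re(u · limitWeight) > 0`, then
the printed Yang–Baxter vertex functional `VF_D(a, f₀; ·)` is NOT identically zero in the angle: its zero set in `(0, π)` is finite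
(with `woundCostGE_five` of `PlaquetteWalkHoleRootWoundCostNS` the coefficient of `Z^{4K−4}` is `lead(Z²·Den)^K · woundLimitSum₅ ≠ 0`).
By the PHASE LAW the hypothesis is a statement about the slot signs, `n_{u₁}+n_{u₂} ∈ {4, 5}` and the eighth roots of unity
`ζ₈^{3(n_{VL}+n_{w₁})+2n_{w₂}}` of the cost-`5` members only. [cite: GlazmanManolescu2019, Lemma 2.1 and eq. (1)]
[cite: Glazman2015WeightedSAW, Lemma 3.1 (proof)] -/
theorem vertexFunctional_printed_zero_set_finite_of_halfPlane_five {w f₀ : Face} (hh : holeFaceW w ∉ dom Dl)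
    (hr : RootedFace (dom Dl) (w.side .W) f₀) (u : ℂ)
    (hnn : ∀ ω ∈ (ΩG.setB2a (dom Dl) (w.side .W) f₀).filter (fun ω => ¬ω.Unwound hr),
      (cost (slotOfSide ω.1) ω.2.mids = 5 → 0 ≤ (u * limitWeight (slotOfSide ω.1) ω.2.mids).re) ∧
        (IsNS ω hr → cost (slotOfSide (ω.ext₃ hr).1) (ω.ext₃ hr).2.mids = 5 →
          0 ≤ (u * limitWeight (slotOfSide (ω.ext₃ hr).1) (ω.ext₃ hr).2.mids).re))
    (hpos : ∃ ω ∈ (ΩG.setB2a (dom Dl) (w.side .W) f₀).filter (fun ω => ¬ω.Unwound hr),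
      (cost (slotOfSide ω.1) ω.2.mids = 5 ∧ 0 < (u * limitWeight (slotOfSide ω.1) ω.2.mids).re) ∨
        (IsNS ω hr ∧ cost (slotOfSide (ω.ext₃ hr).1) (ω.ext₃ hr).2.mids = 5 ∧
          0 < (u * limitWeight (slotOfSide (ω.ext₃ hr).1) (ω.ext₃ hr).2.mids).re)) :
    {θ ∈ Set.Ioo 0 π | vertexFunctional (printedWeights θ) tFiveEighths (ybCoeff θ) Dl (w.side .W) f₀ = 0}.Finite ∧
      {θ ∈ Set.Ioo 0 π | vertexFunctional (printedWeights θ) tFiveEighths (ybCoeff θ) Dl (w.side .W) f₀ = 0}.ncard ≤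
        4 * maxExp Dl (w.side .W) f₀ + 1 - 5 := by
  have hsum := woundLimitSum_ne_zero_of_halfPlane Dl (w.side .W) f₀ hr 5 u hnn hpos
  have hcoef : woundLimitCoeff Dl (w.side .W) f₀ hr (maxExp Dl (w.side .W) f₀) 5 ≠ 0 :=
    (woundLimitCoeff_ne_zero_iff Dl (w.side .W) f₀ hr le_rfl 5).2 hsum
  exact vertexFunctional_printed_zero_set_finite_of_woundLimitCoeff_ne_zero Dl (w.side .W) f₀ hr le_rfl
    (woundCostGE_five Dl hh hr) hcoef

end HalfPlane

/-! ## Level-`5` arithmetic: `(ζ⁴ + ζ¹²)² = −2`, real parts of powers of `ζ` -/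

section Arithmetic

/-- `(ζ⁴ + ζ¹²)² = −2` (`ζ⁴ + ζ¹² = i√2`). [cite: GlazmanManolescu2019, §1, eq. (1) (lane plumbing: the limit weight `i√2` of a corner arc)] -/
theorem zeta32_four_add_twelve_sq : (zeta32 ^ 4 + zeta32 ^ 12) ^ 2 = -2 := by
  have h24 : zeta32 ^ 24 = -zeta32 ^ 8 := by
    rw [show (24 : ℕ) = 16 + 8 by norm_num, pow_add, zeta32_pow_sixteen]; ring
  have e : (zeta32 ^ 4 + zeta32 ^ 12) ^ 2 = zeta32 ^ 8 + 2 * zeta32 ^ 16 + zeta32 ^ 24 := by ring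
  rw [e, h24, zeta32_pow_sixteen]; ring

/-- `(ζ⁴ + ζ¹²)⁴ = 4`: a cost-`5` member with a vertical end (`n_{u₁} + n_{u₂} = 4`) has limit weight `± 4 · ζ₈^{…}`.
[cite: GlazmanManolescu2019, §1, eq. (1) (lane plumbing)] -/
theorem zeta32_four_add_twelve_pow_four : (zeta32 ^ 4 + zeta32 ^ 12) ^ 4 = 4 := by
  rw [show (4 : ℕ) = 2 * 2 by norm_num, pow_mul, zeta32_four_add_twelve_sq]; norm_num

/-- `(ζ⁴ + ζ¹²)⁵ = 4(ζ⁴ + ζ¹²)`: a cost-`5` member with a slanted end (`n_{u₁} + n_{u₂} = 5`) has limit weight `± 4(ζ⁴ + ζ¹²)ζ₈^{…}`.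
[cite: GlazmanManolescu2019, §1, eq. (1) (lane plumbing)] -/
theorem zeta32_four_add_twelve_pow_five : (zeta32 ^ 4 + zeta32 ^ 12) ^ 5 = 4 * (zeta32 ^ 4 + zeta32 ^ 12) := by
  rw [pow_succ, zeta32_four_add_twelve_pow_four]

/-- `Re ζ^k = cos(kπ/16)`. [cite: GlazmanManolescu2019, §1, eq. (1) (lane plumbing)] -/
theorem zeta32_pow_re (k : ℕ) : (zeta32 ^ k).re = Real.cos (k * π / 16) := by
  rw [zeta32_pow, Complex.exp_ofReal_mul_I_re]

/-- `Im ζ^k = sin(kπ/16)`. [cite: GlazmanManolescu2019, §1, eq. (1) (lane plumbing)] -/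
theorem zeta32_pow_im (k : ℕ) : (zeta32 ^ k).im = Real.sin (k * π / 16) := by
  rw [zeta32_pow, Complex.exp_ofReal_mul_I_im]

/-- `Re ζ^k ≥ 0` for `k ≤ 8` (arguments in `[0, π/2]`). [cite: GlazmanManolescu2019, §1, eq. (1) (lane plumbing)] -/
theorem zeta32_pow_re_nonneg {k : ℕ} (hk : k ≤ 8) : 0 ≤ (zeta32 ^ k).re := by
  rw [zeta32_pow_re]
  apply Real.cos_nonneg_of_mem_Icc
  have hk' : (k : ℝ) ≤ 8 := by exact_mod_cast hk
  constructor <;> nlinarith [Real.pi_pos, hk', (Nat.cast_nonneg k : (0 : ℝ) ≤ k)]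

/-- `Re ζ^k > 0` for `k < 8`. [cite: GlazmanManolescu2019, §1, eq. (1) (lane plumbing)] -/
theorem zeta32_pow_re_pos {k : ℕ} (hk : k < 8) : 0 < (zeta32 ^ k).re := by
  rw [zeta32_pow_re]
  apply Real.cos_pos_of_mem_Ioo
  have hk' : (k : ℝ) < 8 := by exact_mod_cast hk
  constructor <;> nlinarith [Real.pi_pos, hk', (Nat.cast_nonneg k : (0 : ℝ) ≤ k)]

/-- `Re ζ^k ≥ 0` for `24 ≤ k ≤ 32` (arguments in `[3π/2, 2π]`). [cite: GlazmanManolescu2019, §1, eq. (1) (lane plumbing)] -/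
theorem zeta32_pow_re_nonneg' {k : ℕ} (hk : 24 ≤ k) (hk' : k ≤ 32) : 0 ≤ (zeta32 ^ k).re := by
  have e : zeta32 ^ k = zeta32 ^ 32 * (zeta32 ^ (32 - k))⁻¹ := by
    rw [eq_mul_inv_iff_mul_eq₀ (pow_ne_zero _ zeta32_ne_zero), ← pow_add, show k + (32 - k) = 32 by omega]
  have hinv : (zeta32 ^ (32 - k))⁻¹ = starRingEnd ℂ (zeta32 ^ (32 - k)) := by
    rw [zeta32_pow, ← Complex.exp_conj, ← Complex.exp_neg]
    congr 1
    rw [map_mul, Complex.conj_ofReal, Complex.conj_I]; ring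
  rw [e, zeta32_pow_thirtyTwo, one_mul, hinv, Complex.conj_re]
  exact zeta32_pow_re_nonneg (by omega)

end Arithmetic

end Literature.Barriers.CriticalPhenomena.PlaquetteWalk
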